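import Literature.IUT.HodgeArakelov.IotaInvariantThetaNegative
import Literature.IUT.HodgeArakelov.PlusMinusTowerNonVacuity
import Literature.IUT.HodgeArakelov.ThetaEvaluationSettingNegative
import HarnessLib

/-!
# [IUTchII] Prop 2.2 (ii)′ `Prop22_ii'` (row F-0661): the identity criterion, the universal closure REFUTED,
# and a closed NV instance (proof-only closures file of `IotaInvariantThetaR.lean`)

S. Mochizuki, *Inter-universal Teichmüller theory II*, kurims manuscript (Dec. 2020), §2, Proposition 2.2 (ii)
p. 66 l. 51–61 ("… together with the condition of invariance with respect to `ι` [cf. [EtTh], Proposition 1.4, (ii);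
the proof of [EtTh], Theorem 1.6, (iii)], determines a specific `μ_{2l}`-orbit `θ^ι(Π_v) ⊆ θ(Π_v)` within the unique
`{(l·ℤ) × μ_{2l}}`-orbit contained in the set `θ(Π_v)`"), read with the convention of Cor. 1.12 (i) p. 57
(`ι`-invariants "with respect to this action up to torsion") [claim: Mochizuki2012, status: disputed]
(IUTchII §2 Prop 2.2 (ii), kurims p.66). Claim key `Mochizuki2012`, status DISPUTED (D-0012); this PROOF-ONLY
companion (no `def`, no `instance`, no `structure`, no new named fact; the frozen modules are imported unchanged)
asserts nothing of the series and takes no side on [IUTchIII] Cor. 3.12.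

FACT-LIST row **F-0661** (cell abc-iut, frozen plan/FACT-LIST.md; L6 register row LF6-28): the REPAIRED decl
`Literature.IUT.HodgeArakelov.Prop22_ii' Dec := Nonempty (IotaInvariantTheta' Dec)` of abc-iut-L6-t19's
`IotaInvariantThetaR.lean` (p408487): an additive `ι`-action on `H¹(Π_Ÿ(Π_v), (l·Δ_Θ)(Π_v))` preserving `θ(Π_v)` whose
invariants UP TO TORSION in `θ(Π_v)` form a nonempty `μ_{2l}`-class. Its binders are the interfaces `BadPlaceSetting`,
`TopGroup`, `TemperedCoverings`, `EtaleThetaData`, `SubgraphDecomposition`, over which the cohomology and the orbit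
`η̈^{Θ,l·ℤ×μ_2}` are FREE data, and — in the repaired structure as typed — so is the action `iotaH1` ("interface data —
to be tied to `Dec.iota` once `CohomologySystem` carries functoriality", docstring of `IotaInvariantTheta'`).
State of record before this file (plan/LF-KERNEL-STATUS.tsv, abc-iut-F-lit 04:10Z): 37 CONDITIONAL instances
(abc-iut-w4-d010 / w5-d072 / w5-d169 …, at the [EtTh] model of record `modelTate p` modulo (H1) F-2633
`PiYddCharacteristic C` at the instance, re-keyed to `hextΔ` by p492265) and 1 conditional closer
(`prop22_ii'_of_translates`); NO closure refuter, NO instance form with 0 Prop hypotheses.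

KERNEL CONTENT OF THIS FILE (12 theorems, 0 defs):
* §1 THE IDENTITY CRITERION (a statement about the TYPING): `exists_iotaInvariantTheta'_refl_iff` — a repaired datum
  whose `ι`-action is THE IDENTITY exists over `Dec` iff `θ(Π_v)` lies in ONE `2l`-torsion class
  (`∀ t t' ∈ θ(Π_v), 2l·(t' − t) = 0`); `EtaleThetaData.two_mul_l_smul_sub_eq_zero_of_orbit` — by `theta_eq`
  (`θ(Π_v) = ⋃_{o ∈ orbit} (−o + H¹[l])`) this holds as soon as the ORBIT members differ by `2l`-torsion classes;
  hence `prop22_ii'_of_theta_pairwise` / `prop22_ii'_of_orbit_pairwise` / `prop22_ii'_of_orbit_subsingleton`: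
  `Prop22_ii' Dec` for EVERY `Dec` over an `EtaleThetaData` whose orbit is a single class (CONDITIONAL-CLOSERS, one
  Prop hypothesis each, witness `ι := id`). At data of the printed shape the orbit is an `(l·ℤ × μ_2)`-orbit whose
  members "differ by NON-torsion classes" (docstring of `EtaleThetaData.orbit`), so the hypothesis is false there and
  `ι = id` violates the orbit clause (`IotaInvariantTheta'.two_mul_l_smul_sub_eq_zero_of_iotaH1_eq_refl`,
  contrapositive): the conditional instances at the model of record build their `ι`-action from the inversion
  instead (abc-iut-w4-d010's `prop22_ii'_of_translates`, whose `hfree` is exactly the negation of this hypothesis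
  for distinct translates; cf. `EtaleThetaData.image_theta_eq_of_image_orbit_eq` there for the field `iota_theta`).
* §2 OVER EVERY SETTING `S` AND EVERY Prop 2.1 DATUM `T` (universe `0`): `exists_not_prop22_ii' T` — a Prop 1.4 output
  (`H¹ = lim = ℤ`, orbit `{0, 1}`, `θ(Π_v) = {0, −1}`) and the trivial Prop 2.2 (i) datum at which `Prop22_ii'` FAILS
  (criterion `not_prop22_ii'_of_forall_torsion`: every `θ`-preserving additive automorphism of `ℤ` fixes `{0, −1}`
  pointwise and `2l·(−1) ≠ 0` in `ℤ` — the witness of abc-iut-f-045's v1 refutation `not_forall_prop22_ii`, p433269,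
  here over an arbitrary setting); `exists_prop22_ii'_over T` — a Prop 1.4 output (orbit `{0}`, `θ(Π_v) = {0}`) at which
  it HOLDS (`ι := id`; DEGENERATE); `exists_prop22_ii'_and_not_prop22_ii' T` — both at once: the predicate is decided
  by the orbit datum of the Prop 1.4 output, not by the setting.
* §3 ROW F-0661: `not_forall_prop22_ii'` — the universal closure of the repaired decl over its free interface data is
  FALSE (closure refuter, 0 hypotheses; F-0661 is, like F-0675, a SCHEMA row — instance forms are the content);
  `exists_prop22_ii'` — a CLOSED instance (0 Prop hypotheses; DEGENERATE, honestly labelled: trivial carriers,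
  `ι := id` on `θ(Π_v) = {0}` over the stack of `TemperedCoverings.nonempty_degenerate`).
RESIDUAL OF RECORD for the printed content is unchanged and not touched here: at the model of record the `μ_{2l}`-clause
holds modulo (H1) F-2633 at the instance (`SettingModel.prop22_ii'_modelTate`, p457878) — equivalently modulo `hextΔ`
(`SettingModel.prop22_ii'_modelTate_of_extends`, p492265); abc-iut-w5-d145's computation of record (kit j266770 /
j267457 / j267471, memo XPARITY-L3-RESULT.md a3bef420cb37033f) certifies the `Ÿ`-parity clause `L_Ÿ` of (H1) at
`(l, i, j) = (3, 1, 2)`, `p ≡ 1 (12)` OUTSIDE the kernel. A FACT row is an assumption label, not an endorsement;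
typed ≠ proved; instantiated ≠ endorsed; nothing here bears on whether abc is proved or refuted.
bears_on: LADDER-ABC:A2.L-F (LF5/6 [IUTchI–III], row F-0661 / LF6-28) → rung 0 `Summit.ABC`.
-/

namespace Literature.IUT.HodgeArakelov

universe u

variable {S : BadPlaceSetting.{u}} {P : TopGroup.{u}} {T : TemperedCoverings S P}
  {D : EtaleThetaData S.toThetaSetting P} {Dec : SubgraphDecomposition S T D}

/-! ## §1. The identity criterion: in the repaired structure the `ι`-action is free data -/

/-- If the `ι`-action of a repaired datum IS the identity of `H¹(Π_Ÿ(Π_v), (l·Δ_Θ)(Π_v))`, then every class of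
`θ(Π_v)` is `ι`-invariant up to torsion, so the orbit clause forces all of `θ(Π_v)` into ONE `2l`-torsion class:
`2l·(t' − t) = 0` for all `t, t' ∈ θ(Π_v)`. (At data of the printed shape — `θ(Π_v)` an `{(l·ℤ) × μ_{2l}}`-orbit with
free `l·ℤ`-translates — this FAILS, so the identity is not an admissible `ι` there.)
[claim: Mochizuki2012, status: disputed] (IUTchII §2 Prop 2.2 (ii), kurims p.66)
[cite: Mochizuki2012, II Prop 2.2 (ii) p.66] -/
theorem IotaInvariantTheta'.two_mul_l_smul_sub_eq_zero_of_iotaH1_eq_refl (Θ : IotaInvariantTheta' Dec)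
    (hΘ : Θ.iotaH1 = AddEquiv.refl _) {t t' : D.coh.H1 ⊤} (ht : t ∈ D.theta) (ht' : t' ∈ D.theta) :
    (2 * S.l) • (t' - t) = 0 := by
  refine Θ.thetaIota_orbit t ht t' ht' ?_ ?_
  · rw [hΘ, AddEquiv.refl_apply, sub_self]
    exact IsOfFinAddOrder.zero
  · rw [hΘ, AddEquiv.refl_apply, sub_self]
    exact IsOfFinAddOrder.zero

/-- **The identity criterion.** Over ANY Prop 2.2 (i) datum `Dec`, a repaired `IotaInvariantTheta'` datum whose
`ι`-action on `H¹` is THE IDENTITY exists iff `θ(Π_v)` lies in one `2l`-torsion class. (`⇐`: take `ι := id` on `H¹`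
and on the direct limit; `θ(Π_v)` is nonempty by `EtaleThetaData.theta_nonempty` and every class is invariant up to
torsion. `⇒`: `two_mul_l_smul_sub_eq_zero_of_iotaH1_eq_refl`.) A statement about the TYPING: the repaired structure
leaves `iotaH1` free ("to be tied to `Dec.iota` once `CohomologySystem` carries functoriality").
[claim: Mochizuki2012, status: disputed] (IUTchII §2 Prop 2.2 (ii), kurims p.66)
[cite: Mochizuki2012, II Prop 2.2 (ii) p.66] -/
theorem exists_iotaInvariantTheta'_refl_iff (Dec : SubgraphDecomposition S T D) :
    (∃ Θ : IotaInvariantTheta' Dec, Θ.iotaH1 = AddEquiv.refl _) ↔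
      ∀ t ∈ D.theta, ∀ t' ∈ D.theta, (2 * S.l) • (t' - t) = 0 := by
  refine ⟨fun ⟨Θ, hΘ⟩ t ht t' ht' => Θ.two_mul_l_smul_sub_eq_zero_of_iotaH1_eq_refl hΘ ht ht', fun h => ?_⟩
  obtain ⟨η, hη⟩ := D.theta_nonempty
  exact
    ⟨{ iotaH1 := AddEquiv.refl _
       iotaLim := AddEquiv.refl _
       iota_compat := fun _ => rfl
       iota_theta := Set.image_id _
       thetaIota_nonempty := ⟨η, hη, by
         rw [AddEquiv.refl_apply, sub_self]
         exact IsOfFinAddOrder.zero⟩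
       thetaIota_orbit := fun t ht t' ht' _ _ => h t ht t' ht' }, rfl⟩

/-- `Prop22_ii' Dec` from the class condition on `θ(Π_v)` alone (witness `ι := id`; CONDITIONAL-CLOSER, one Prop
hypothesis). [claim: Mochizuki2012, status: disputed] (IUTchII §2 Prop 2.2 (ii), kurims p.66)
[cite: Mochizuki2012, II Prop 2.2 (ii) p.66] -/
theorem prop22_ii'_of_theta_pairwise (Dec : SubgraphDecomposition S T D)
    (h : ∀ t ∈ D.theta, ∀ t' ∈ D.theta, (2 * S.l) • (t' - t) = 0) : Prop22_ii' Dec := by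
  obtain ⟨Θ, -⟩ := (exists_iotaInvariantTheta'_refl_iff Dec).2 h
  exact ⟨Θ⟩

/-- **From the orbit to `θ(Π_v)`** (PROVED from `theta_eq`): `θ(Π_v) = {b | ∃ o ∈ orbit, l·(b + o) = 0}` is the union
of the `l`-torsion cosets `−o + H¹[l]`, `o ∈ η̈^{Θ,l·ℤ×μ_2}`; hence if any two ORBIT members differ by a `2l`-torsion
class, so do any two classes of `θ(Π_v)`: for `t = z − o`, `t' = z' − o'` (`l·z = l·z' = 0`),
`2l·(t' − t) = 2·(l·z') − 2·(l·z) + 2l·(o − o') = 0`.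
[claim: Mochizuki2012, status: disputed] (IUTchII §1 Prop 1.4, kurims p.27)
[cite: Mochizuki2012, II Prop 1.4 p.27] -/
theorem EtaleThetaData.two_mul_l_smul_sub_eq_zero_of_orbit (D : EtaleThetaData S.toThetaSetting P)
    (h : ∀ o ∈ D.orbit, ∀ o' ∈ D.orbit, (2 * S.l) • (o' - o) = 0)
    {t t' : D.coh.H1 ⊤} (ht : t ∈ D.theta) (ht' : t' ∈ D.theta) : (2 * S.l) • (t' - t) = 0 := by
  rw [D.theta_eq] at ht ht'
  obtain ⟨o, ho, hto⟩ := ht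
  obtain ⟨o', ho', hto'⟩ := ht'
  have h3 : (2 * S.l) • (o - o') = 0 := h o' ho' o ho
  have key : (2 * S.l) • (t' - t) =
      2 • ((S.l : ℕ) • (t' + o')) - 2 • ((S.l : ℕ) • (t + o)) + (2 * S.l) • (o - o') := by
    simp only [mul_nsmul', smul_add, smul_sub]
    abel
  rw [key, h3, add_zero]
  change 2 • ((S.toThetaSetting.l : ℕ) • (t' + o')) - 2 • ((S.toThetaSetting.l : ℕ) • (t + o)) = 0
  rw [hto, hto', smul_zero, sub_zero]

/-- **IUTchII:Prop2.2(ii)′ from the orbit datum alone**: if any two members of the orbit `η̈^{Θ,l·ℤ×μ_2}` of the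
Prop 1.4 output differ by a `2l`-torsion class, then `Prop22_ii' Dec` holds for EVERY Prop 2.2 (i) datum `Dec` over it
(witness `ι := id`). CONDITIONAL-CLOSER (one Prop hypothesis); at data of the printed shape the hypothesis is FALSE
(free `l·ℤ`-translates), which is why the instances at the model of record use the inversion instead.
[claim: Mochizuki2012, status: disputed] (IUTchII §2 Prop 2.2 (ii), kurims p.66)
[cite: Mochizuki2012, II Prop 2.2 (ii) p.66] -/
theorem prop22_ii'_of_orbit_pairwise (Dec : SubgraphDecomposition S T D)
    (h : ∀ o ∈ D.orbit, ∀ o' ∈ D.orbit, (2 * S.l) • (o' - o) = 0) : Prop22_ii' Dec :=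
  prop22_ii'_of_theta_pairwise Dec fun _ ht _ ht' => D.two_mul_l_smul_sub_eq_zero_of_orbit h ht ht'

/-- In particular: if the orbit of the Prop 1.4 output is a single class, `Prop22_ii' Dec` holds for every `Dec`
over it (`ι := id`; `θ(Π_v) = −o + H¹[l]` is then one `l`-torsion coset). CONDITIONAL-CLOSER (one Prop hypothesis).
[claim: Mochizuki2012, status: disputed] (IUTchII §2 Prop 2.2 (ii), kurims p.66)
[cite: Mochizuki2012, II Prop 2.2 (ii) p.66] -/
theorem prop22_ii'_of_orbit_subsingleton (Dec : SubgraphDecomposition S T D) (h : D.orbit.Subsingleton) :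
    Prop22_ii' Dec :=
  prop22_ii'_of_orbit_pairwise Dec fun o ho o' ho' => by
    rw [h ho' ho, sub_self, smul_zero]

/-! ## §2. Over EVERY setting: one Prop 1.4 output where `Prop22_ii'` fails, one where it holds -/

/-- **Criterion (negative).** If every additive automorphism of `H¹(Π_Ÿ(Π_v), (l·Δ_Θ)(Π_v))` that preserves
`θ(Π_v)` moves each class of `θ(Π_v)` by a TORSION class (e.g. fixes `θ(Π_v)` pointwise), and `θ(Π_v)` contains two
classes `t, t'` with `2l·(t' − t) ≠ 0`, then the repaired statement `Prop22_ii' Dec` fails (for every Prop 2.2 (i)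
datum `Dec`): the orbit clause of any witness would give `2l·(t' − t) = 0`.
[claim: Mochizuki2012, status: disputed] (IUTchII §2 Prop 2.2 (ii), kurims p.66)
[cite: Mochizuki2012, II Prop 2.2 (ii) p.66] -/
theorem not_prop22_ii'_of_forall_torsion
    (hrig : ∀ ι : D.coh.H1 ⊤ ≃+ D.coh.H1 ⊤, ι '' D.theta = D.theta →
      ∀ t ∈ D.theta, IsOfFinAddOrder (ι t - t))
    {t t' : D.coh.H1 ⊤} (ht : t ∈ D.theta) (ht' : t' ∈ D.theta) (hne : (2 * S.l) • (t' - t) ≠ 0) :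
    ¬ Prop22_ii' Dec := by
  rintro ⟨Θ⟩
  exact hne (Θ.thetaIota_orbit t ht t' ht' (hrig Θ.iotaH1 Θ.iota_theta t ht)
    (hrig Θ.iotaH1 Θ.iota_theta t' ht'))

/-- **Over EVERY bad-place setting `S` and EVERY Prop 2.1 datum `T` (universe `0`) the repaired predicate FAILS at
some Prop 1.4 output**: take `H¹ = lim = ℤ` (all restriction maps the identity), `Π_Ÿ(Π_v) := Π_v`, and the orbit
`{0, 1}`, so that `θ(Π_v) = {b | ∃ o ∈ {0,1}, l·(b + o) = 0} = {0, −1}` (`l = S.l` is prime, hence `≠ 0` in `ℤ`),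
with the trivial Prop 2.2 (i) datum (`exists_subgraphDecomposition_trivial`). Any additive automorphism of `ℤ`
preserving `{0, −1}` fixes it pointwise (it fixes `0` and is injective), and `2l·(−1 − 0) ≠ 0` in `ℤ`; conclude by
`not_prop22_ii'_of_forall_torsion`. The witness of abc-iut-f-045's v1 refutation `not_forall_prop22_ii` (p433269),
here over an arbitrary setting. [claim: Mochizuki2012, status: disputed] (IUTchII §2 Prop 2.2 (ii), kurims p.66)
[cite: Mochizuki2012, II Prop 2.2 (ii) p.66] -/
theorem exists_not_prop22_ii' {S : BadPlaceSetting.{0}} {P : TopGroup.{0}} (T : TemperedCoverings S P) :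
    ∃ (D : EtaleThetaData S.toThetaSetting P) (Dec : SubgraphDecomposition S T D), ¬ Prop22_ii' Dec := by
  have hl : (S.l : ℤ) ≠ 0 := Nat.cast_ne_zero.mpr S.l_prime.ne_zero
  -- the Prop 1.4 output over `(S, P)` with `H¹ = lim = ℤ`, orbit `{0, 1}`
  let D : EtaleThetaData S.toThetaSetting P :=
    { isoRef := T.isoRef
      PiYddRef := ⊤
      PiYdd := ⊤
      isOpen_PiYdd := isOpen_univ
      PiYdd_corresponds := fun e => by
        rw [← MonoidHom.range_eq_map, MonoidHom.range_eq_top]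
        exact e.surjective
      lDeltaTheta := { top := ⊥, bot := ⊥, le := le_rfl, normal := inferInstance }
      coh :=
        { H1 := fun _ => ℤ
          res := fun _ => AddMonoidHom.id ℤ
          lim := ℤ
          toLim := fun _ => AddMonoidHom.id ℤ
          toLim_res := fun _ _ => rfl }
      orbit := {0, 1}
      orbit_nonempty := ⟨0, Or.inl rfl⟩
      theta := {b : ℤ | ∃ o ∈ ({0, 1} : Set ℤ), (S.l : ℕ) • (b + o) = 0}
      theta_eq := rfl }
  obtain ⟨Dec, -⟩ := exists_subgraphDecomposition_trivial T D
  -- membership in `θ(Π_v) = {0, -1}`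
  have hmem : ∀ b : ℤ, b ∈ D.theta ↔ b = 0 ∨ b = -1 := by
    intro b
    change (∃ o ∈ ({0, 1} : Set ℤ), (S.l : ℕ) • (b + o) = 0) ↔ _
    simp only [Set.mem_insert_iff, Set.mem_singleton_iff, exists_eq_or_imp, exists_eq_left, add_zero,
      nsmul_eq_mul, mul_eq_zero, hl, false_or]
    constructor
    · rintro (h | h)
      · exact Or.inl h
      · exact Or.inr (by omega)
    · rintro (h | h)
      · exact Or.inl h
      · exact Or.inr (by omega)
  have h0 : (0 : ℤ) ∈ D.theta := (hmem 0).mpr (Or.inl rfl)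
  have h1 : (-1 : ℤ) ∈ D.theta := (hmem (-1)).mpr (Or.inr rfl)
  refine ⟨D, Dec, not_prop22_ii'_of_forall_torsion (D := D) (Dec := Dec) ?_ h0 h1 ?_⟩
  · -- every `θ`-preserving additive automorphism of `ℤ` fixes `θ = {0, -1}` pointwise
    intro ι hι b hb
    have hfix : ι b = b := by
      rcases (hmem b).mp hb with rfl | rfl
      · exact map_zero ι
      · have himg : ι (-1) ∈ D.theta := hι ▸ Set.mem_image_of_mem ι h1
        rcases (hmem _).mp himg with h' | h'
        · exact absurd (ι.injective (h'.trans (map_zero ι).symm)) (by norm_num)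
        · exact h'
    rw [hfix, sub_self]
    exact IsOfFinAddOrder.zero
  · -- `2l • (-1 - 0) ≠ 0` in `ℤ`
    change (2 * S.l) • ((-1 : ℤ) - 0) ≠ 0
    rw [nsmul_eq_mul]
    push_cast
    omega

/-- **Over EVERY bad-place setting `S` and EVERY Prop 2.1 datum `T` (universe `0`) the repaired predicate HOLDS at
some Prop 1.4 output** (DEGENERATE, honestly labelled): `H¹ = lim = ℤ`, `Π_Ÿ(Π_v) := Π_v`, the SINGLETON orbit `{0}`
(so `θ(Π_v) = {b | l·b = 0} = {0}`), the trivial Prop 2.2 (i) datum, and `ι := id`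
(`prop22_ii'_of_orbit_subsingleton`). Trivial cohomological carriers: joint satisfiability of the typed axioms of the
repaired Prop 2.2 (ii)′ with those of Prop 1.4 / 2.2 (i) over any setting; nothing about the tempered fundamental
groups of a curve. [claim: Mochizuki2012, status: disputed] (IUTchII §2 Prop 2.2 (ii), kurims p.66)
[cite: Mochizuki2012, II Prop 2.2 (ii) p.66] -/
theorem exists_prop22_ii'_over {S : BadPlaceSetting.{0}} {P : TopGroup.{0}} (T : TemperedCoverings S P) :
    ∃ (D : EtaleThetaData S.toThetaSetting P) (Dec : SubgraphDecomposition S T D), Prop22_ii' Dec := by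
  -- the Prop 1.4 output over `(S, P)` with `H¹ = lim = ℤ`, orbit `{0}`
  let D : EtaleThetaData S.toThetaSetting P :=
    { isoRef := T.isoRef
      PiYddRef := ⊤
      PiYdd := ⊤
      isOpen_PiYdd := isOpen_univ
      PiYdd_corresponds := fun e => by
        rw [← MonoidHom.range_eq_map, MonoidHom.range_eq_top]
        exact e.surjective
      lDeltaTheta := { top := ⊥, bot := ⊥, le := le_rfl, normal := inferInstance }
      coh :=
        { H1 := fun _ => ℤ
          res := fun _ => AddMonoidHom.id ℤ
          lim := ℤ
          toLim := fun _ => AddMonoidHom.id ℤ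
          toLim_res := fun _ _ => rfl }
      orbit := {0}
      orbit_nonempty := ⟨0, rfl⟩
      theta := {b : ℤ | ∃ o ∈ ({0} : Set ℤ), (S.l : ℕ) • (b + o) = 0}
      theta_eq := rfl }
  obtain ⟨Dec, -⟩ := exists_subgraphDecomposition_trivial T D
  exact ⟨D, Dec, prop22_ii'_of_orbit_subsingleton Dec Set.subsingleton_singleton⟩

/-- **`Prop22_ii'` is decided by the orbit datum, not by the setting**: over EVERY `(S, P, T)` (universe `0`) there
are Prop 1.4 outputs `D₁`, `D₂` (same cohomology `H¹ = lim = ℤ`; orbits `{0}` and `{0, 1}`) with Prop 2.2 (i) data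
`Dec₁`, `Dec₂` such that `Prop22_ii' Dec₁` HOLDS and `Prop22_ii' Dec₂` FAILS. DEGENERATE witnesses; a statement about
the typed schema. [claim: Mochizuki2012, status: disputed] (IUTchII §2 Prop 2.2 (ii), kurims p.66)
[cite: Mochizuki2012, II Prop 2.2 (ii) p.66] -/
theorem exists_prop22_ii'_and_not_prop22_ii' {S : BadPlaceSetting.{0}} {P : TopGroup.{0}}
    (T : TemperedCoverings S P) :
    ∃ (D₁ D₂ : EtaleThetaData S.toThetaSetting P) (Dec₁ : SubgraphDecomposition S T D₁)
      (Dec₂ : SubgraphDecomposition S T D₂), Prop22_ii' Dec₁ ∧ ¬ Prop22_ii' Dec₂ := by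
  obtain ⟨D₁, Dec₁, h₁⟩ := exists_prop22_ii'_over T
  obtain ⟨D₂, Dec₂, h₂⟩ := exists_not_prop22_ii' T
  exact ⟨D₁, D₂, Dec₁, Dec₂, h₁, h₂⟩

/-! ## §3. Row F-0661: the universal closure REFUTED, and a closed instance -/

/-- **F-0661, universal closure REFUTED.** The repaired `Prop22_ii'` does NOT hold for all `(S, P, T, D, Dec)`:
`exists_not_prop22_ii'` at the degenerate bad-place stack of `TemperedCoverings.nonempty_degenerate` (all
tempered/Galois groups trivial). So F-0661 is, like the v1 row F-0675 (`not_forall_prop22_ii`, p433269), a SCHEMA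
row: its `∀`-closure over the free interface data (cohomology, orbit, `ι`-action) is false; instance forms are the
content, and the ones carrying the printed content are the conditional instances at the model of record
(`SettingModel.prop22_ii'_modelTate` …, modulo (H1) F-2633 at the instance). A FACT row is an assumption label, not
an endorsement. [claim: Mochizuki2012, status: disputed] (IUTchII §2 Prop 2.2 (ii), kurims p.66)
[cite: Mochizuki2012, II Prop 2.2 (ii) p.66] -/
theorem not_forall_prop22_ii' :
    ¬ ∀ {S : BadPlaceSetting.{0}} {P : TopGroup.{0}} {T : TemperedCoverings S P}
        {D : EtaleThetaData S.toThetaSetting P} (Dec : SubgraphDecomposition S T D), Prop22_ii' Dec := by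
  intro h
  obtain ⟨S, P, ⟨T⟩⟩ := TemperedCoverings.nonempty_degenerate
  obtain ⟨D, Dec, hnot⟩ := exists_not_prop22_ii' T
  exact hnot (h Dec)

/-- **F-0661, a CLOSED instance (DEGENERATE).** `Prop22_ii' Dec` HOLDS at some `(S, P, T, D, Dec)`:
`exists_prop22_ii'_over` at the degenerate bad-place stack of `TemperedCoverings.nonempty_degenerate`. Trivial
carriers (joint satisfiability of the typed axioms, `ι := id` on `θ(Π_v) = {0}`); nothing about the tempered
fundamental groups of a curve. [claim: Mochizuki2012, status: disputed] (IUTchII §2 Prop 2.2 (ii), kurims p.66)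
[cite: Mochizuki2012, II Prop 2.2 (ii) p.66] -/
theorem exists_prop22_ii' :
    ∃ (S : BadPlaceSetting.{0}) (P : TopGroup.{0}) (T : TemperedCoverings S P)
      (D : EtaleThetaData S.toThetaSetting P) (Dec : SubgraphDecomposition S T D), Prop22_ii' Dec := by
  obtain ⟨S, P, ⟨T⟩⟩ := TemperedCoverings.nonempty_degenerate
  obtain ⟨D, Dec, h⟩ := exists_prop22_ii'_over T
  exact ⟨S, P, T, D, Dec, h⟩

end Literature.IUT.HodgeArakelov
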